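import Summits.CriticalPhenomena.PercolationContinuityZ3.Theorems.PercNearOneGluingNoHeavyPcintNawChainMemSym
import HarnessLib

/-!
# PCINT lane, reduction B2d (`nawfree_cw`: delayed chain payments with free-neighbour shares) on the memory-`τ`
# DANGEROUS-SET automaton — definitions

Cell `prim-pcint` (PAPER-2 track (iii)), seat `prim-pcint-1` (gen 6); support file (`--supports stmt-CriticalPhenomena-4575`).
Does NOT build on p205010.  Memo: run/shared/lean/prim/pcint/REDUCTIONS.md §B2d (prim-pcint-1 gen 6).

The automaton runs on the dangerous-set states of `…PcintNawRandMem` (`nstep τ`).  Reading letter `a` from state `S` it forms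
the KNOWN VERTICES `fK S a` (positions relative to the NEW vertex, ages relative to it: the new vertex `(0,0)`, the previous
endpoint `(-e_a, 1)`, and the remembered sites shifted and aged).  The PSEUDO-TIP is the known vertex of age `kt`; every
lattice neighbour `w` of it that is not a known position is inspected: its VISIBLE INCIDENCES `finc` are the known vertices
adjacent to `w`; its FREE NEIGHBOURS `ffree` are the lattice neighbours of `w` that are neither known positions nor CERTIFIED
off-path (`fcert`: adjacent to a known vertex of age `A ≥ 1` with `A + 1 + ℓ¹ ≤ τ`).  Two kinds of payment: PREPAY (a visible
incidence of age `kt - 2`: the forward corner partner is paid now) and SELF (no incidence of age `kt + 2` can exist —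
`kt + 3 + ℓ¹(w) ≤ τ` makes its absence certain — and some other incidence is visible).  Each payment at `w` is worth
`qv (fcnt w)`, `fcnt = #finc + #ffree` (an upper bound for the total number of incidences of `w`, `…NawFreeMemAlong`), for a
weight family `qv : ℕ → ℝ` (intended `qv k ≥ (1-p)^{1/k}`).  Payments are UNCONDITIONAL when two visible incidences are `≥ 4`
apart in age (`funcond`), CONDITIONAL at the syntactic forward corner site of the pseudo-tip (`fcorner`), and not made
elsewhere.  Step factor `fwt = fU · ((1 + fC)/2)^{[fhasC]}`; automaton `freeMemAut τ kt p qv`.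
-/

noncomputable section

namespace Summit.CriticalPhenomena.PercolationContinuityZ3.Theorems.Pcint

open Finset Literature.Probability.Percolation Literature.Probability.LatticeModels

variable {d : ℕ}

/-! ### Step data of the delayed free-neighbour rule -/

section StepData

variable (τ kt : ℕ)

/-- The KNOWN VERTICES after reading letter `a` from state `S`: `(position - e_a, age + 1)` for the remembered sites, the
previous endpoint `(-e_a, 1)` and the new vertex `(0, 0)` (positions relative to the new vertex). [folklore] -/
def fK (S : MState d) (a : Fin d × Bool) : Finset (Site d × ℕ) :=
  insert ((0 : Site d), 0) (insert (-stepVec a, 1) (S.image fun q => (q.1 - stepVec a, q.2 + 1)))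

/-- The known positions. [folklore] -/
def fpos (S : MState d) (a : Fin d × Bool) : Finset (Site d) := (fK S a).image Prod.fst

/-- Membership in `fK`. [folklore] -/
theorem mem_fK {S : MState d} {a : Fin d × Bool} {q : Site d × ℕ} :
    q ∈ fK S a ↔ q = (0, 0) ∨ q = (-stepVec a, 1) ∨ ∃ r ∈ S, (r.1 - stepVec a, r.2 + 1) = q := by
  unfold fK; rw [mem_insert, mem_insert, mem_image]

/-- Membership in `fpos`. [folklore] -/
theorem mem_fpos {S : MState d} {a : Fin d × Bool} {x : Site d} : x ∈ fpos S a ↔ ∃ A, (x, A) ∈ fK S a := by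
  unfold fpos; rw [mem_image]
  exact ⟨fun ⟨q, hq, hx⟩ => ⟨q.2, by rw [← hx]; exact hq⟩, fun ⟨A, h⟩ => ⟨(x, A), h, rfl⟩⟩

/-- The INSPECTED SITES: lattice neighbours of a known vertex of age `kt` (the pseudo-tip) that are not known positions.
[folklore] -/
def fsites (S : MState d) (a : Fin d × Bool) : Finset (Site d) :=
  ((fK S a).filter fun q => q.2 = kt).biUnion fun q => (nbrSites q.1).filter fun w => w ∉ fpos S a

/-- Membership in `fsites`. [folklore] -/
theorem mem_fsites {S : MState d} {a : Fin d × Bool} {w : Site d} :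
    w ∈ fsites kt S a ↔ ∃ P, (P, kt) ∈ fK S a ∧ (zdGraph d).Adj P w ∧ w ∉ fpos S a := by
  unfold fsites; rw [mem_biUnion]
  constructor
  · rintro ⟨q, hq, hw⟩
    obtain ⟨hqK, hqa⟩ := mem_filter.1 hq
    obtain ⟨hw1, hw2⟩ := mem_filter.1 hw
    refine ⟨q.1, ?_, mem_nbrSites.1 hw1, hw2⟩
    have : q = (q.1, kt) := Prod.ext rfl hqa
    rw [← this]; exact hqK
  · rintro ⟨P, hP, hadj, hw⟩
    exact ⟨(P, kt), mem_filter.2 ⟨hP, rfl⟩, mem_filter.2 ⟨mem_nbrSites.2 hadj, hw⟩⟩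

/-- The VISIBLE INCIDENCES of a site: known vertices adjacent to it. [folklore] -/
def finc (S : MState d) (a : Fin d × Bool) (w : Site d) : Finset (Site d × ℕ) :=
  (fK S a).filter fun q => (zdGraph d).Adj q.1 w

/-- Membership in `finc`. [folklore] -/
theorem mem_finc {S : MState d} {a : Fin d × Bool} {w : Site d} {q : Site d × ℕ} :
    q ∈ finc S a w ↔ q ∈ fK S a ∧ (zdGraph d).Adj q.1 w := mem_filter

/-- CERTIFIED off-path (Boolean): adjacent to a known vertex of age `A ≥ 1` with `A + 1 + ℓ¹(u) ≤ τ`. [folklore] -/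
def fcert (S : MState d) (a : Fin d × Bool) (u : Site d) : Bool :=
  decide (∃ q ∈ fK S a, 1 ≤ q.2 ∧ q.2 + 1 + l1 u ≤ τ ∧ (zdGraph d).Adj q.1 u)

/-- What `fcert = true` says. [folklore] -/
theorem fcert_iff {S : MState d} {a : Fin d × Bool} {u : Site d} :
    fcert τ S a u = true ↔ ∃ q ∈ fK S a, 1 ≤ q.2 ∧ q.2 + 1 + l1 u ≤ τ ∧ (zdGraph d).Adj q.1 u := by
  unfold fcert; rw [decide_eq_true_iff]

/-- The FREE NEIGHBOURS of a site: lattice neighbours that are neither known positions nor certified. [folklore] -/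
def ffree (S : MState d) (a : Fin d × Bool) (w : Site d) : Finset (Site d) :=
  (nbrSites w).filter fun u => u ∉ fpos S a ∧ fcert τ S a u = false

/-- Membership in `ffree`. [folklore] -/
theorem mem_ffree {S : MState d} {a : Fin d × Bool} {w u : Site d} :
    u ∈ ffree τ S a w ↔ (zdGraph d).Adj w u ∧ u ∉ fpos S a ∧ fcert τ S a u = false := by
  unfold ffree; rw [mem_filter, mem_nbrSites]

/-- The COUNT of a site: visible incidences plus free neighbours (an upper bound for all its incidences). [folklore] -/
def fcnt (S : MState d) (a : Fin d × Bool) (w : Site d) : ℕ := (finc S a w).card + (ffree τ S a w).card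

/-- PREPAY (Boolean): a visible incidence of age `kt - 2` (the forward corner partner of the pseudo-tip). [folklore] -/
def fprepay (S : MState d) (a : Fin d × Bool) (w : Site d) : Bool := decide (∃ q ∈ finc S a w, q.2 + 2 = kt)

/-- SELF payment (Boolean): the absence of an incidence of age `kt + 2` is certain (`kt + 3 + ℓ¹(w) ≤ τ` and none is visible)
and at least two incidences are visible. [folklore] -/
def fself (S : MState d) (a : Fin d × Bool) (w : Site d) : Bool :=
  decide (kt + 3 + l1 w ≤ τ ∧ (∀ q ∈ finc S a w, q.2 ≠ kt + 2) ∧ 2 ≤ (finc S a w).card)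

/-- What `fprepay = true` says. [folklore] -/
theorem fprepay_iff {S : MState d} {a : Fin d × Bool} {w : Site d} :
    fprepay kt S a w = true ↔ ∃ q ∈ finc S a w, q.2 + 2 = kt := by
  unfold fprepay; rw [decide_eq_true_iff]

/-- What `fself = true` says. [folklore] -/
theorem fself_iff {S : MState d} {a : Fin d × Bool} {w : Site d} :
    fself τ kt S a w = true ↔ kt + 3 + l1 w ≤ τ ∧ (∀ q ∈ finc S a w, q.2 ≠ kt + 2) ∧ 2 ≤ (finc S a w).card := by
  unfold fself; rw [decide_eq_true_iff]

/-- Number of payments at the site: `[prepay] + [self]`. [folklore] -/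
def fnpay (S : MState d) (a : Fin d × Bool) (w : Site d) : ℕ :=
  (if fprepay kt S a w then 1 else 0) + (if fself τ kt S a w then 1 else 0)

/-- `fnpay ≤ 2`. [folklore] -/
theorem fnpay_le_two (S : MState d) (a : Fin d × Bool) (w : Site d) : fnpay τ kt S a w ≤ 2 := by
  unfold fnpay; split_ifs <;> omega

/-- UNCONDITIONAL (Boolean): two visible incidences at least four apart in age (a gap-`≥ 4` pair: the site is forced for every
sibling order). [folklore] -/
def funcond (S : MState d) (a : Fin d × Bool) (w : Site d) : Bool :=
  decide (∃ q ∈ finc S a w, ∃ q' ∈ finc S a w, q.2 + 4 ≤ q'.2)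

/-- What `funcond = true` says. [folklore] -/
theorem funcond_iff {S : MState d} {a : Fin d × Bool} {w : Site d} :
    funcond S a w = true ↔ ∃ q ∈ finc S a w, ∃ q' ∈ finc S a w, q.2 + 4 ≤ q'.2 := by
  unfold funcond; rw [decide_eq_true_iff]

/-- CORNER (Boolean): `w` is the syntactic forward corner site `P + x₂ - x₁` of the pseudo-tip `P` (age `kt`), where `x₁`, `x₂`
are the known vertices of ages `kt - 1`, `kt - 2`. [folklore] -/
def fcorner (S : MState d) (a : Fin d × Bool) (w : Site d) : Bool :=
  decide (∃ P ∈ fpos S a, ∃ x₁ ∈ fpos S a, ∃ x₂ ∈ fpos S a,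
    (P, kt) ∈ fK S a ∧ (x₁, kt - 1) ∈ fK S a ∧ (x₂, kt - 2) ∈ fK S a ∧ w = P + x₂ - x₁)

/-- What `fcorner = true` says. [folklore] -/
theorem fcorner_iff {S : MState d} {a : Fin d × Bool} {w : Site d} :
    fcorner kt S a w = true ↔
      ∃ P x₁ x₂, (P, kt) ∈ fK S a ∧ (x₁, kt - 1) ∈ fK S a ∧ (x₂, kt - 2) ∈ fK S a ∧ w = P + x₂ - x₁ := by
  unfold fcorner; rw [decide_eq_true_iff]
  constructor
  · rintro ⟨P, -, x₁, -, x₂, -, h⟩; exact ⟨P, x₁, x₂, h⟩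
  · rintro ⟨P, x₁, x₂, hP, h1, h2, hw⟩
    exact ⟨P, mem_fpos.2 ⟨_, hP⟩, x₁, mem_fpos.2 ⟨_, h1⟩, x₂, mem_fpos.2 ⟨_, h2⟩, hP, h1, h2, hw⟩

/-- CONDITIONAL (Boolean): not unconditional, and the corner site. [folklore] -/
def fcond (S : MState d) (a : Fin d × Bool) (w : Site d) : Bool := !funcond S a w && fcorner kt S a w

/-- What `fcond = true` says. [folklore] -/
theorem fcond_iff {S : MState d} {a : Fin d × Bool} {w : Site d} :
    fcond kt S a w = true ↔ funcond S a w = false ∧ fcorner kt S a w = true := by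
  unfold fcond; rw [Bool.and_eq_true, Bool.not_eq_true']

/-- The UNCONDITIONAL factor of the step: `∏_{w unconditional} qv(fcnt w)^{fnpay w}`. [folklore] -/
def fU (qv : ℕ → ℝ) (S : MState d) (a : Fin d × Bool) : ℝ :=
  ∏ w ∈ fsites kt S a, if funcond S a w then qv (fcnt τ S a w) ^ fnpay τ kt S a w else 1

/-- The CONDITIONAL factor of the step: `∏_{w conditional} qv(fcnt w)^{fnpay w}`. [folklore] -/
def fC (qv : ℕ → ℝ) (S : MState d) (a : Fin d × Bool) : ℝ :=
  ∏ w ∈ fsites kt S a, if fcond kt S a w then qv (fcnt τ S a w) ^ fnpay τ kt S a w else 1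

/-- Whether the step has a conditional payment. [folklore] -/
def fhasC (S : MState d) (a : Fin d × Bool) : Bool :=
  decide (∃ w ∈ fsites kt S a, fcond kt S a w = true ∧ fnpay τ kt S a w ≠ 0)

/-- What `fhasC = true` says. [folklore] -/
theorem fhasC_iff {S : MState d} {a : Fin d × Bool} :
    fhasC τ kt S a = true ↔ ∃ w ∈ fsites kt S a, fcond kt S a w = true ∧ fnpay τ kt S a w ≠ 0 := by
  unfold fhasC; rw [decide_eq_true_iff]

/-- The symmetric step factor `fU · ((1 + fC)/2)^{[fhasC]}`. [folklore] -/
def fwt (qv : ℕ → ℝ) (S : MState d) (a : Fin d × Bool) : ℝ :=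
  fU τ kt qv S a * (if fhasC τ kt S a then (1 + fC τ kt qv S a) / 2 else 1)

variable {τ kt}

/-- `fU ≥ 0` for a nonnegative family. [folklore] -/
theorem fU_nonneg {qv : ℕ → ℝ} (hq : ∀ k, 0 ≤ qv k) (S : MState d) (a : Fin d × Bool) : 0 ≤ fU τ kt qv S a :=
  prod_nonneg fun w _ => by split_ifs <;> [exact pow_nonneg (hq _) _; exact zero_le_one]

/-- `fC ≥ 0` for a nonnegative family. [folklore] -/
theorem fC_nonneg {qv : ℕ → ℝ} (hq : ∀ k, 0 ≤ qv k) (S : MState d) (a : Fin d × Bool) : 0 ≤ fC τ kt qv S a :=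
  prod_nonneg fun w _ => by split_ifs <;> [exact pow_nonneg (hq _) _; exact zero_le_one]

/-- `fU ≤ 1` for a family in `[0,1]`. [folklore] -/
theorem fU_le_one {qv : ℕ → ℝ} (hq : ∀ k, 0 ≤ qv k) (hq1 : ∀ k, qv k ≤ 1) (S : MState d) (a : Fin d × Bool) :
    fU τ kt qv S a ≤ 1 :=
  prod_le_one (fun w _ => by split_ifs <;> [exact pow_nonneg (hq _) _; exact zero_le_one])
    fun w _ => by split_ifs <;> [exact pow_le_one₀ (hq _) (hq1 _); exact le_rfl]

/-- `fC ≤ 1` for a family in `[0,1]`. [folklore] -/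
theorem fC_le_one {qv : ℕ → ℝ} (hq : ∀ k, 0 ≤ qv k) (hq1 : ∀ k, qv k ≤ 1) (S : MState d) (a : Fin d × Bool) :
    fC τ kt qv S a ≤ 1 :=
  prod_le_one (fun w _ => by split_ifs <;> [exact pow_nonneg (hq _) _; exact zero_le_one])
    fun w _ => by split_ifs <;> [exact pow_le_one₀ (hq _) (hq1 _); exact le_rfl]

/-- The step factor is nonnegative. [folklore] -/
theorem fwt_nonneg {qv : ℕ → ℝ} (hq : ∀ k, 0 ≤ qv k) (S : MState d) (a : Fin d × Bool) : 0 ≤ fwt τ kt qv S a := by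
  unfold fwt
  have h1 := fU_nonneg (τ := τ) (kt := kt) hq S a
  have h2 := fC_nonneg (τ := τ) (kt := kt) hq S a
  split_ifs <;> positivity

/-- The step factor is at most one (family in `[0,1]`). [folklore] -/
theorem fwt_le_one {qv : ℕ → ℝ} (hq : ∀ k, 0 ≤ qv k) (hq1 : ∀ k, qv k ≤ 1) (S : MState d) (a : Fin d × Bool) :
    fwt τ kt qv S a ≤ 1 := by
  unfold fwt
  have h1 := fU_le_one (τ := τ) (kt := kt) hq hq1 S a
  have h1' := fU_nonneg (τ := τ) (kt := kt) hq S a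
  have h2 := fC_le_one (τ := τ) (kt := kt) hq hq1 S a
  split_ifs
  · calc fU τ kt qv S a * ((1 + fC τ kt qv S a) / 2) ≤ 1 * 1 :=
        mul_le_mul h1 (by linarith) (by linarith [fC_nonneg (τ := τ) (kt := kt) hq S a]) zero_le_one
      _ = 1 := one_mul _
  · rw [mul_one]; exact h1

variable (τ kt)

/-- **The B2d automaton on dangerous-set states** with weight `p · fwt`. [folklore] -/
def freeMemAut (p : ℝ) (qv : ℕ → ℝ) (hp : 0 ≤ p) (hq : ∀ k, 0 ≤ qv k) : WAut (MState d) (Fin d × Bool) where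
  step := nstep τ
  wt S a := p * fwt τ kt qv S a
  wt_nonneg S a := mul_nonneg hp (fwt_nonneg hq S a)

end StepData

end Summit.CriticalPhenomena.PercolationContinuityZ3.Theorems.Pcint
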